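import Summits.AtomisticToContinuum.HydrodynamicLimit.Theorems.LambertianContactSwapLambertianEulerKineticHeartOfInputs
import Summits.AtomisticToContinuum.HydrodynamicLimit.Theorems.LambertianContactSwapLambertianEulerCollisionalHeartOfInputs
import Summits.AtomisticToContinuum.HydrodynamicLimit.Theorems.LambertianContactSwapLambertianEulerInBandOfHearts
import HarnessLib

/-!
# The typed split of crux `LambertianContactSwap.LambertianEuler` (stmt-AtomisticToContinuum-11854) into the line's research inputs and its residual

Crux-strategist support file (`--supports stmt-AtomisticToContinuum-11854`; protocol (b) DECOMPOSITION: the implication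
`Sub₁ → … → Sub_k → LambertianEuler` landed BEFORE `ledger route edit … --split LambertianEuler`).  The crux AS TYPED (unguarded:
every classical hs-Euler solution on `[0,T)`) is, kernel-checked, the composition of FOUR pieces that already live in the tree as
named statements — the lead's research inputs (`Cruxes/LambertianEuler/INPUTS.md`, line `Sketch` v37) and the shared PDE residual:

* `Sub₁` **window large deviations under local-Gibbs restart** — the conjunction of KCW-Λ
  `…KineticInputs.KineticClampedWindowLDLambda` (clamped fast kinetic current) and CCW-Λ
  `…CollisionalInputs.CollisionalClampedWindowLDLambda` (clamped collisional functional): the local ergodic theorem of the Lambertian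
  gas in the finite-`N`, log-moment-generating-function form the relative-entropy method consumes (MacroErgodicity slot; noisy gas);
* `Sub₂` **Gaussian velocity tails along `Λ` under the true law** — TL1G-Λ `…KineticInputs.GaussianVelocityTailsLambda`
  (HighMomentumCutoff slot, cubic weight);
* `Sub₃` **collision-activity tails along `Λ` under the true law** — CAT-Λ `…CollisionalInputs.CollisionActivityTailsLambda`;
* `Sub₄` **dilute self-consistency** — `ImplosionDichotomy.DiluteSelfConsistency` (stmt-AtomisticToContinuum-3091; expected FALSE by
  its own chain, `DiluteSelfConsistency ↔ ¬DenseExcursion` landed): consumed ONLY to discharge the packing guard, i.e. the residual of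
  the crux as typed over the packing-guarded `…HeartsLog.LambertianEulerInBand` (D-0032 shape).

`lambertianEuler_of_subs : Sub₁ → Sub₂ → Sub₃ → Sub₄ → LambertianEuler` is the landed glue of the lead's line read as a split:
`kineticOneBlockInMeanLambdaLog_of_inputs` (p139979) and `collisionalOneBlockInMeanLambdaLog_of_inputs` (p146028) give the two
log-hearts, `lambertianEulerInBand_of_hearts` the guarded crux, `lambertianEuler_of_inBand` (p138618) the unguarding by `Sub₄`.
Also recorded: the guarded corollary WITHOUT `Sub₄` (`lambertianEulerInBand_of_subs` — what a re-glued deciding theorem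
`SwapGap → LambertianEulerInBand → HydrodynamicLimit` would consume; strategist census stmt-11854 gen 1/2), the sister route's copy
(`LindebergRandomFuture.LambertianEuler`, byte-identical body), and the unbundled five-premise form (for a `--resplit` at `k = 5`).
Crux-strategist planner-cstrat-stmt-AtomisticToContinuum-11854-s2-0, 2026-08-17.  [cite: Yau1991, §2] [cite: OllaVaradhanYau1993, §3–§4]
-/

noncomputable section

namespace Summit.AtomisticToContinuum.HydrodynamicLimit.Theorems.LambertianContactSwapLambertianEulerSplit

open Summit.AtomisticToContinuum.HydrodynamicLimit.Theorems.LambertianContactSwapLambertianEulerKineticInputs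
  (KineticClampedWindowLDLambda GaussianVelocityTailsLambda)
open Summit.AtomisticToContinuum.HydrodynamicLimit.Theorems.LambertianContactSwapLambertianEulerCollisionalInputs
  (CollisionalClampedWindowLDLambda CollisionActivityTailsLambda)
open Summit.AtomisticToContinuum.HydrodynamicLimit.Theorems.LambertianContactSwapLambertianEulerHeartsLog
  (KineticOneBlockInMeanLambdaLog CollisionalOneBlockInMeanLambdaLog LambertianEulerInBand)
open Summit.AtomisticToContinuum.HydrodynamicLimit.Theorems.LambertianContactSwapLambertianEulerKineticHeartOfInputs
  (kineticOneBlockInMeanLambdaLog_of_inputs)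
open Summit.AtomisticToContinuum.HydrodynamicLimit.Theorems.LambertianContactSwapLambertianEulerCollisionalHeartOfInputs
  (collisionalOneBlockInMeanLambdaLog_of_inputs)
open Summit.AtomisticToContinuum.HydrodynamicLimit.Theorems.LambertianContactSwapLambertianEulerInBandOfHearts
  (lambertianEulerInBand_of_hearts lambertianEuler_of_inBand)

/-! ## §1 The guarded crux from the three research pieces (no residual) -/

/-- **`Sub₁ → Sub₂ → Sub₃ → LambertianEulerInBand`**: the packing-guarded Euler limit of the Lambertian gas from the window large
deviations (KCW-Λ ∧ CCW-Λ), the Gaussian velocity tails (TL1G-Λ) and the collision-activity tails (CAT-Λ) — the two log-hearts by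
`…_of_inputs`, then `lambertianEulerInBand_of_hearts`.  No dilute self-consistency in the cone. [folklore] -/
theorem lambertianEulerInBand_of_subs
    (hW : KineticClampedWindowLDLambda ∧ CollisionalClampedWindowLDLambda)
    (hT : GaussianVelocityTailsLambda) (hA : CollisionActivityTailsLambda) : LambertianEulerInBand :=
  lambertianEulerInBand_of_hearts (kineticOneBlockInMeanLambdaLog_of_inputs hW.1 hT)
    (collisionalOneBlockInMeanLambdaLog_of_inputs hW.2 hA hT)

/-! ## §2 The crux as typed from the four pieces (the split's glue) -/

/-- **THE SPLIT'S GLUE — `Sub₁ → Sub₂ → Sub₃ → Sub₄ → LambertianContactSwap.LambertianEuler`.**  The crux AS TYPED (unguarded) from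
window LD (KCW-Λ ∧ CCW-Λ), Gaussian velocity tails (TL1G-Λ), collision-activity tails (CAT-Λ) and dilute self-consistency
(stmt-3091, the residual that discharges the packing guard of `LambertianEulerInBand`). [folklore] -/
theorem lambertianEuler_of_subs
    (hW : KineticClampedWindowLDLambda ∧ CollisionalClampedWindowLDLambda)
    (hT : GaussianVelocityTailsLambda) (hA : CollisionActivityTailsLambda)
    (hD : Summit.AtomisticToContinuum.HydrodynamicLimit.Theses.ImplosionDichotomy.DiluteSelfConsistency) :
    Summit.AtomisticToContinuum.HydrodynamicLimit.Theses.LambertianContactSwap.LambertianEuler :=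
  lambertianEuler_of_inBand (lambertianEulerInBand_of_subs hW hT hA) hD

/-- Protocol alias (`<CruxDecl>_of_subs`). [folklore] -/
theorem LambertianEuler_of_subs :
    (KineticClampedWindowLDLambda ∧ CollisionalClampedWindowLDLambda) → GaussianVelocityTailsLambda →
      CollisionActivityTailsLambda →
      Summit.AtomisticToContinuum.HydrodynamicLimit.Theses.ImplosionDichotomy.DiluteSelfConsistency →
      Summit.AtomisticToContinuum.HydrodynamicLimit.Theses.LambertianContactSwap.LambertianEuler :=
  lambertianEuler_of_subs

/-- The same for the sister route's copy `LindebergRandomFuture.LambertianEuler` (byte-identical body; shared node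
stmt-11854). [folklore] -/
theorem lindebergRandomFuture_lambertianEuler_of_subs
    (hW : KineticClampedWindowLDLambda ∧ CollisionalClampedWindowLDLambda)
    (hT : GaussianVelocityTailsLambda) (hA : CollisionActivityTailsLambda)
    (hD : Summit.AtomisticToContinuum.HydrodynamicLimit.Theses.ImplosionDichotomy.DiluteSelfConsistency) :
    Summit.AtomisticToContinuum.HydrodynamicLimit.Theses.LindebergRandomFuture.LambertianEuler :=
  lambertianEuler_of_subs hW hT hA hD

/-! ## §3 The unbundled five-premise form (for a `--resplit` with `k = 5`) -/

/-- `KCW-Λ → TL1G-Λ → CCW-Λ → CAT-Λ → LambertianEulerInBand` (guarded; no residual). [folklore] -/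
theorem lambertianEulerInBand_of_inputs (hK : KineticClampedWindowLDLambda) (hT : GaussianVelocityTailsLambda)
    (hC : CollisionalClampedWindowLDLambda) (hA : CollisionActivityTailsLambda) : LambertianEulerInBand :=
  lambertianEulerInBand_of_subs ⟨hK, hC⟩ hT hA

/-- `KCW-Λ → TL1G-Λ → CCW-Λ → CAT-Λ → DiluteSelfConsistency → LambertianEuler` (the four research inputs one by one). [folklore] -/
theorem lambertianEuler_of_inputs (hK : KineticClampedWindowLDLambda) (hT : GaussianVelocityTailsLambda)
    (hC : CollisionalClampedWindowLDLambda) (hA : CollisionActivityTailsLambda)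
    (hD : Summit.AtomisticToContinuum.HydrodynamicLimit.Theses.ImplosionDichotomy.DiluteSelfConsistency) :
    Summit.AtomisticToContinuum.HydrodynamicLimit.Theses.LambertianContactSwap.LambertianEuler :=
  lambertianEuler_of_inBand (lambertianEulerInBand_of_inputs hK hT hC hA) hD

end Summit.AtomisticToContinuum.HydrodynamicLimit.Theorems.LambertianContactSwapLambertianEulerSplit
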